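import Summits.BirchSwinnertonDyer.BirchSwinnertonDyer.Theses.GoldfeldAllTwistsTwoConverse
import Summits.BirchSwinnertonDyer.BirchSwinnertonDyer.Theorems.GoldfeldGoodTwistsAllTwistsCells
import Summits.BirchSwinnertonDyer.Rank1Residual.X12.CMSmallPrimePConverse
import Literature.NumberTheory.EllipticCurves.SelmerCorankHolds
import Literature.NumberTheory.EllipticCurves.IwasawaLeadingTermProofs
import Literature.NumberTheory.EllipticCurves.SupersingularDensityProofs
import Literature.NumberTheory.EllipticCurves.BSDSelmerPParityUnfoldingProofs
import HarnessLib

set_option linter.dupNamespace false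
set_option autoImplicit false

/-!
# Crux K12₂″: the ODD-PRIME SWITCH — `corank₂ = 1` plus finiteness of `Ш[p^∞]` at ONE odd good-ordinary
# prime `p` gives `ord_{s=1} L = 1` from print, and the resulting L-free shape of the crux

Cell `bsd-goldfeld`, prover seat `s1p-c201` (gen 2), item `stmt-BirchSwinnertonDyer-20044` (crux K12₂″ =
`Theses.GoldfeldAllTwistsTwoConverse.RankOneTwoConverseCMSevenAdditiveTwo`: for a globally minimal elliptic
`W/ℚ` with `j(W) = −3375` and NOT good reduction at `2`, `corank_{ℤ₂} Sel_{2^∞}(W/ℚ) = 1 ⟹ ord_{s=1} L(W, s) = 1`).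
The crux is OPEN; nothing in this file asserts it. What this file proves, sorry-free, with no claim binder:

§1 **The switch (a print-conditional RUNG on a sub-locus).** For every globally minimal `W/ℚ` with
`j(W) = −3375` (ANY reduction at `2`), every prime `q` with `corank_{ℤ_q} Sel_{q^∞}(W/ℚ) = 1`, and every prime
`p` of good ORDINARY reduction with `corank_{ℤ_p} Ш(W/ℚ)[p^∞] = 0` (i.e. `Ш[p^∞]` finite): `ord_{s=1} L(W, s) = 1`.
Inputs, all existing tree objects: the PROVED corank identity `corank Sel_{ℓ^∞} = rank + corank Ш[ℓ^∞]`
(`WeierstrassCurve.selmerCorank_eq_mordellWeilRank_add_holds`, Greenberg LNM 1716 §1) at `ℓ = q` and `ℓ = p`,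
which gives `corank_p = rank ≤ corank_q = 1`; the `p`-PARITY theorem at `q` and at `p` (Dokchitser–Dokchitser
2010 Thm. 1.4, tree fact `p_parity`, binder `hpar`, through the tree theorem
`selmerCorank_mod_two_eq_of_forall_p_parity`: `corank_p ≡ corank_q ≡ 1 (mod 2)`), whence `corank_p = 1`; and
Burungale–Castella–Skinner–Tian 2022 Thm. A AT THE PRIME `p` (tree fact
`thmA_analyticRank_eq_one_of_selmerCorank_eq_one` = the route's own support item `BCSTThmARankOneConverse`,
binder `hA`; its conductor hypothesis `𝔡_K ∥ 𝔣_λ` is automatic for `K = ℚ(√−7)`, tree theorem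
`X12.differentExactlyDividesHeckeConductor_of_cmFieldDiscrOfJ_eq_neg_seven`). At `q = 2` on the additive cell
this is K12₂″ ON THE SUB-LOCUS `{W : Ш(W)[p^∞] finite for some odd good-ordinary p}` — where every printed
rank-one CM `p`-converse (Rubin 1991/1992, Burungale–Tian 2020, BCST 2022; `p` odd, good ordinary = split in
`ℚ(√−7)`, `p ∤ 7·N_W`) is available, and where the wild prime `2` never enters.

§2 **The L-free leaf.** `ShaCorankZeroOddPrimeCMSevenAdditiveTwo` (OPEN, `@[conjecture]`, nothing asserted):
for `W` in the additive cell with `corank₂ Sel_{2^∞}(W) = 1` there is an ODD prime `p` of good ordinary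
reduction with `corank_{ℤ_p} Ш(W)[p^∞] = 0`. It mentions no `L`-function and no `2`-adic analysis: it is a
weak, one-prime form of the finiteness of `Ш` (equivalently: `p`-INDEPENDENCE of the Selmer corank between
`2` and one odd ordinary prime, given parity). §1 gives leaf ⟹ crux (`…_of_shaCorankZeroOddPrime`); crux ⟹
leaf is Gross–Zagier–Kolyvagin (`r_an = 1 ⟹ Ш finite`, tree fact `rank_eq_analyticRank_of_analyticRank_le_one`,
binder `hGZK`) plus the EXISTENCE of an odd good-ordinary prime (tree theorem
`infinite_goodOrdinaryPrimes_holds`, Deuring/Serre); so K12₂″ ⟺ leaf modulo print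
(`rankOneTwoConverseCMSevenAdditiveTwo_iff_shaCorankZeroOddPrime`). This is the fourth typed shape of the
crux (after the three `K`-level leaves of `GoldfeldK12AdditiveTwoBaseChange` / `…Descent` / `…Heegner`,
gen 0), and the only one in which the `2`-adic difficulty (BCST Rem. D: additive, residually reducible
`W[2](ℚ) = ℤ/2`, `2 = #𝒪_K^×`) is traded for an ALGEBRAIC statement at an odd prime. It is not claimed to be
easier: for a single `W` it is decided by an odd `𝔭`-descent (no `L`-values), but for the class it is a
`Ш`-finiteness statement — recorded in the cell memo K12PP-LEAF §4 (H-D) as "no easier, but the only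
reformulation whose deep input is fully in print".

No `sorry`, no new axiom, no instance, no notation. Binders are existing cite-tagged tree facts only:
`thmA_analyticRank_eq_one_of_selmerCorank_eq_one` (BCST Thm. A), `p_parity` (Dokchitser–Dokchitser Thm. 1.4),
`rank_eq_analyticRank_of_analyticRank_le_one` (Gross–Zagier–Kolyvagin).

References: A. Burungale, F. Castella, C. Skinner, Y. Tian, Ann. Math. Qué. 46 (2022) Thm. A, Rem. D
[BurungaleCastellaSkinnerTian2022]; T. and V. Dokchitser, Ann. of Math. 172 (2010) Thm. 1.4
[DokchitserDokchitserAnnals2010]; R. Greenberg, LNM 1716 (1999) §1 [Greenberg1999LNM]; H. Darmon, CBMS 101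
(2004) Thm. 3.22 [Darmon2004]; J.-P. Serre, IHÉS 54 (1981) §8 [Serre1981].
-/

noncomputable section

open scoped Classical

open WeierstrassCurve Literature.NumberTheory.EllipticCurves
open Literature.NumberTheory.EllipticCurves.BurungaleCastellaSkinnerTian2022

namespace Summit.BirchSwinnertonDyer.BirchSwinnertonDyer.Theorems.GoldfeldGoodTwists

open Summit.BirchSwinnertonDyer.Rank1Residual

/-! ## §1 The odd-prime switch -/

/-- **Prime switch for BCST Thm. A (CM curve satisfying the conductor hypothesis).** For a globally
minimal CM curve `W/ℚ` with `𝔡_K ∥ 𝔣_λ` (`DifferentExactlyDividesHeckeConductor W`), a prime `q` with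
`corank_{ℤ_q} Sel_{q^∞}(W/ℚ) = 1`, and a prime `p` of good ordinary reduction (`p ∤ a_p`) with
`corank_{ℤ_p} Ш(W/ℚ)[p^∞] = 0`: `ord_{s=1} L(W, s) = 1`. Proof: `corank_p = rank + 0 ≤ rank + corank Ш[q^∞] =
corank_q = 1` (proved corank identity at `p` and `q`), `corank_p ≡ corank_q (mod 2)` (`p`-parity at both
primes, binder `hpar`), so `corank_p = 1`, and BCST Thm. A at `p` (binder `hA`) concludes. The prime `q` (in the
application `q = 2`, additive) never meets a `q`-adic argument.
[cite: BurungaleCastellaSkinnerTian2022, Thm. A (p. 326)] [cite: DokchitserDokchitserAnnals2010, Thm. 1.4]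
[cite: Greenberg1999LNM, §1 pp. 54–57] -/
theorem analyticRank_eq_one_of_selmerCorank_eq_one_of_shaCorank_eq_zero_of_thmA
    (hA : thmA_analyticRank_eq_one_of_selmerCorank_eq_one)
    (hpar : ∀ (W : WeierstrassCurve ℚ) [W.IsElliptic] (p : ℕ) [Fact p.Prime], p_parity W p)
    (W : WeierstrassCurve ℚ) [W.IsElliptic] [W.IsGloballyMinimal] (hCM : W.HasCM)
    (hcond : DifferentExactlyDividesHeckeConductor W) (q : ℕ) [Fact q.Prime]
    (hq : W.selmerCorank q = 1) (p : ℕ) [Fact p.Prime] (hgood : W.HasGoodReductionAtPrime p)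
    (hord : ¬ (p : ℤ) ∣ W.frobeniusTrace p) (hsha : W.shaCorank p = 0) : W.analyticRank = 1 := by
  have hidp := W.selmerCorank_eq_mordellWeilRank_add_holds p
  have hidq := W.selmerCorank_eq_mordellWeilRank_add_holds q
  have hmod := selmerCorank_mod_two_eq_of_forall_p_parity hpar W p q
  have hp1 : W.selmerCorank p = 1 := by omega
  exact hA W hCM hcond p hgood hord hp1

/-- **The switch on the `ℚ(√−7)` locus, `j = −3375` (ANY reduction at `2`).** For a globally minimal
`W/ℚ` with `j(W) = −3375` (CM by `ℤ[(1+√−7)/2]`; BCST's conductor hypothesis automatic), a prime `q` with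
`corank_{ℤ_q} Sel_{q^∞}(W/ℚ) = 1` and a good ordinary prime `p` with `corank_{ℤ_p} Ш(W)[p^∞] = 0`:
`ord_{s=1} L(W, s) = 1`. [cite: BurungaleCastellaSkinnerTian2022, Thm. A (p. 326), Rem. D (p. 327)]
[cite: DokchitserDokchitserAnnals2010, Thm. 1.4] -/
theorem analyticRank_eq_one_of_j_neg3375_of_selmerCorank_eq_one_of_shaCorank_eq_zero
    (hA : thmA_analyticRank_eq_one_of_selmerCorank_eq_one)
    (hpar : ∀ (W : WeierstrassCurve ℚ) [W.IsElliptic] (p : ℕ) [Fact p.Prime], p_parity W p)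
    (W : WeierstrassCurve ℚ) [W.IsElliptic] [W.IsGloballyMinimal] (hj : W.j = -3375)
    (q : ℕ) [Fact q.Prime] (hq : W.selmerCorank q = 1) (p : ℕ) [Fact p.Prime]
    (hgood : W.HasGoodReductionAtPrime p) (hord : ¬ (p : ℤ) ∣ W.frobeniusTrace p)
    (hsha : W.shaCorank p = 0) : W.analyticRank = 1 :=
  have hCM : W.HasCM := hasCM_of_j_eq_neg3375 W hj
  analyticRank_eq_one_of_selmerCorank_eq_one_of_shaCorank_eq_zero_of_thmA hA hpar W hCM
    (X12.differentExactlyDividesHeckeConductor_of_cmFieldDiscrOfJ_eq_neg_seven W hCM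
      (cmFieldDiscrOfJ_eq_neg_seven_of_j_eq W (Or.inl hj))) q hq p hgood hord hsha

/-- **K12₂″ ON THE SUB-LOCUS `{Ш[p^∞] finite at one odd good-ordinary p}` — a print-conditional rung
of item 20044, in the crux's own binders.** For `W` globally minimal, `j(W) = −3375`, NOT good at `2`,
`corank_{ℤ₂} Sel_{2^∞}(W/ℚ) = 1`: if SOME prime `p ≠ 2` of good ordinary reduction has
`corank_{ℤ_p} Ш(W)[p^∞] = 0`, then `ord_{s=1} L(W, s) = 1`. The additivity at `2` is not used (the
switch never looks at `2`-adic objects); it is carried to match the crux verbatim.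
[cite: BurungaleCastellaSkinnerTian2022, Thm. A (p. 326), Rem. D (p. 327)]
[cite: DokchitserDokchitserAnnals2010, Thm. 1.4] -/
theorem rankOneTwoConverseCMSevenAdditiveTwo_on_shaFiniteOddPrime
    (hA : thmA_analyticRank_eq_one_of_selmerCorank_eq_one)
    (hpar : ∀ (W : WeierstrassCurve ℚ) [W.IsElliptic] (p : ℕ) [Fact p.Prime], p_parity W p)
    (W : WeierstrassCurve ℚ) [W.IsElliptic] [W.IsGloballyMinimal] (hj : W.j = -3375)
    (_h2 : ¬ W.HasGoodReductionAtPrime 2) (hsel : W.selmerCorank 2 = 1)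
    (hX : ∃ (p : ℕ) (_ : Fact p.Prime), p ≠ 2 ∧ W.HasGoodReductionAtPrime p ∧
      ¬ (p : ℤ) ∣ W.frobeniusTrace p ∧ W.shaCorank p = 0) :
    W.analyticRank = 1 := by
  haveI : Fact (2 : ℕ).Prime := ⟨Nat.prime_two⟩
  obtain ⟨p, hp, -, hgood, hord, hsha⟩ := hX
  exact analyticRank_eq_one_of_j_neg3375_of_selmerCorank_eq_one_of_shaCorank_eq_zero hA hpar W hj
    2 hsel p hgood hord hsha

/-! ## §2 The L-free leaf and the equivalence with the crux -/

/-- **LEAF `ShaCorankZeroOddPrimeCMSevenAdditiveTwo` (OPEN; nothing asserted).** For every globally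
minimal elliptic `W/ℚ` with `j(W) = −3375` and NOT good (hence additive) reduction at `2`:
`corank_{ℤ₂} Sel_{2^∞}(W/ℚ) = 1 ⟹` there is a prime `p ≠ 2` of good ORDINARY reduction for `W`
(`p ∤ N_W`, `p ∤ a_p`; for these CM curves: `p` split in `ℚ(√−7)`) with `corank_{ℤ_p} Ш(W/ℚ)[p^∞] = 0`
(equivalently `Ш(W/ℚ)[p^∞]` finite, `finite_primaryComponent_sha_iff_shaCorank_eq_zero`). An `L`-free,
`2`-adic-analysis-free statement: by the proved corank identity and `p`-parity it says exactly that the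
Selmer corank `1` at `2` is also the Selmer corank at ONE odd ordinary prime. A consequence of the
finiteness of `Ш` (so of BSD); for the class of additive `ℚ(√−7)`-twists it is open. Implies crux K12₂″
(`rankOneTwoConverseCMSevenAdditiveTwo_of_shaCorankZeroOddPrime`, via BCST Thm. A at `p`) and follows
from it (`shaCorankZeroOddPrime_of_rankOneTwoConverseCMSevenAdditiveTwo`, via Gross–Zagier–Kolyvagin).
[cite: BurungaleCastellaSkinnerTian2022, Thm. A (p. 326), Rem. D (p. 327)]
[cite: Greenberg1999LNM, §1 pp. 54–57] -/
@[conjecture] def ShaCorankZeroOddPrimeCMSevenAdditiveTwo : Prop :=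
  ∀ (W : WeierstrassCurve ℚ) [W.IsElliptic] [W.IsGloballyMinimal], W.j = -3375 →
    ¬ W.HasGoodReductionAtPrime 2 → W.selmerCorank 2 = 1 →
    ∃ (p : ℕ) (_ : Fact p.Prime), p ≠ 2 ∧ W.HasGoodReductionAtPrime p ∧
      ¬ (p : ℤ) ∣ W.frobeniusTrace p ∧ W.shaCorank p = 0

/-- **Leaf ⟹ crux K12₂″** (BCST Thm. A at the odd prime, `hA`; `p`-parity, `hpar`). The conclusion is the
route decl `Theses.GoldfeldAllTwistsTwoConverse.RankOneTwoConverseCMSevenAdditiveTwo` by name.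
[cite: BurungaleCastellaSkinnerTian2022, Thm. A (p. 326), Rem. D (p. 327)]
[cite: DokchitserDokchitserAnnals2010, Thm. 1.4] -/
theorem rankOneTwoConverseCMSevenAdditiveTwo_of_shaCorankZeroOddPrime
    (hA : thmA_analyticRank_eq_one_of_selmerCorank_eq_one)
    (hpar : ∀ (W : WeierstrassCurve ℚ) [W.IsElliptic] (p : ℕ) [Fact p.Prime], p_parity W p)
    (hX : ShaCorankZeroOddPrimeCMSevenAdditiveTwo) :
    Summit.BirchSwinnertonDyer.BirchSwinnertonDyer.Theses.GoldfeldAllTwistsTwoConverse.RankOneTwoConverseCMSevenAdditiveTwo := by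
  intro W _ _ hj h2 hsel
  exact rankOneTwoConverseCMSevenAdditiveTwo_on_shaFiniteOddPrime hA hpar W hj h2 hsel
    (hX W hj h2 hsel)

/-- **Crux K12₂″ ⟹ leaf** (Gross–Zagier–Kolyvagin `hGZK`: `r_an = 1 ⟹ Ш(W/ℚ)` finite, so EVERY
`Ш[p^∞]` has corank `0`; and a globally minimal elliptic curve over `ℚ` has infinitely many good ordinary
primes — tree theorem `infinite_goodOrdinaryPrimes_holds` — in particular one `> 2`).
[cite: Darmon2004, Thm. 3.22] [cite: Serre1981, §8 Cor. 2] -/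
theorem shaCorankZeroOddPrime_of_rankOneTwoConverseCMSevenAdditiveTwo
    (hGZK : rank_eq_analyticRank_of_analyticRank_le_one)
    (h : Summit.BirchSwinnertonDyer.BirchSwinnertonDyer.Theses.GoldfeldAllTwistsTwoConverse.RankOneTwoConverseCMSevenAdditiveTwo) :
    ShaCorankZeroOddPrimeCMSevenAdditiveTwo := by
  intro W _ _ hj h2 hsel
  have h1 : W.analyticRank = 1 := h W hj h2 hsel
  obtain ⟨-, hfin⟩ := hGZK W h1.le
  obtain ⟨p, ⟨hp, hgood, hord⟩, hlt⟩ := (infinite_goodOrdinaryPrimes_holds W).exists_gt 2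
  haveI := hp
  haveI : Finite W.sha := hfin
  have hsha : W.shaCorank p = 0 :=
    (finite_primaryComponent_sha_iff_shaCorank_eq_zero W p).1 inferInstance
  exact ⟨p, hp, by omega, hgood, hord, hsha⟩

/-- **K12₂″ ⟺ the L-free leaf, modulo print** (BCST Thm. A `hA`, `p`-parity `hpar`,
Gross–Zagier–Kolyvagin `hGZK`). [cite: BurungaleCastellaSkinnerTian2022, Thm. A (p. 326), Rem. D (p. 327)]
[cite: DokchitserDokchitserAnnals2010, Thm. 1.4] [cite: Darmon2004, Thm. 3.22] -/
theorem rankOneTwoConverseCMSevenAdditiveTwo_iff_shaCorankZeroOddPrime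
    (hA : thmA_analyticRank_eq_one_of_selmerCorank_eq_one)
    (hpar : ∀ (W : WeierstrassCurve ℚ) [W.IsElliptic] (p : ℕ) [Fact p.Prime], p_parity W p)
    (hGZK : rank_eq_analyticRank_of_analyticRank_le_one) :
    Summit.BirchSwinnertonDyer.BirchSwinnertonDyer.Theses.GoldfeldAllTwistsTwoConverse.RankOneTwoConverseCMSevenAdditiveTwo ↔
      ShaCorankZeroOddPrimeCMSevenAdditiveTwo :=
  ⟨shaCorankZeroOddPrime_of_rankOneTwoConverseCMSevenAdditiveTwo hGZK,
    rankOneTwoConverseCMSevenAdditiveTwo_of_shaCorankZeroOddPrime hA hpar⟩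

/-- **The binder `hA` is the route's own support item 20045** (`BCSTThmARankOneConverse` is by definition
the BCST Thm. A fact constant): the leaf closes K12₂″ from the SAME two route inputs that close the good
cell of the parent K12₂′ (items 20045/20046), plus `p`-parity. [cite: BurungaleCastellaSkinnerTian2022, Thm. A (p. 326)] -/
theorem rankOneTwoConverseCMSevenAdditiveTwo_of_shaCorankZeroOddPrime_of_item
    (hA : Summit.BirchSwinnertonDyer.BirchSwinnertonDyer.Theses.GoldfeldAllTwistsTwoConverse.BCSTThmARankOneConverse)
    (hpar : ∀ (W : WeierstrassCurve ℚ) [W.IsElliptic] (p : ℕ) [Fact p.Prime], p_parity W p)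
    (hX : ShaCorankZeroOddPrimeCMSevenAdditiveTwo) :
    Summit.BirchSwinnertonDyer.BirchSwinnertonDyer.Theses.GoldfeldAllTwistsTwoConverse.RankOneTwoConverseCMSevenAdditiveTwo :=
  rankOneTwoConverseCMSevenAdditiveTwo_of_shaCorankZeroOddPrime hA hpar hX

/-! ## §3 Up the route: the parent K12₂′ and the rung leaf S1⁺ from the L-free leaf -/

/-- **Parent crux K12₂′ (`RankOneTwoConverseCMSevenAtAnyTwo`, item 19349) from the L-free leaf**, BCST
Thm. A (`hA`, which also closes the GOOD cell — tree theorem `rankOneTwoConverseCMSevenAtAnyTwo_of_additiveCell`,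
file 13) and `p`-parity (`hpar`). Conclusion = the route decl by name.
[cite: BurungaleCastellaSkinnerTian2022, Thm. A (p. 326), Rem. D (p. 327)]
[cite: DokchitserDokchitserAnnals2010, Thm. 1.4] -/
theorem rankOneTwoConverseCMSevenAtAnyTwo_of_shaCorankZeroOddPrime
    (hA : thmA_analyticRank_eq_one_of_selmerCorank_eq_one)
    (hpar : ∀ (W : WeierstrassCurve ℚ) [W.IsElliptic] (p : ℕ) [Fact p.Prime], p_parity W p)
    (hX : ShaCorankZeroOddPrimeCMSevenAdditiveTwo) :
    Summit.BirchSwinnertonDyer.BirchSwinnertonDyer.Theses.GoldfeldAllTwistsTwoConverse.RankOneTwoConverseCMSevenAtAnyTwo :=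
  rankOneTwoConverseCMSevenAtAnyTwo_of_additiveCell hA
    (rankOneTwoConverseCMSevenAdditiveTwo_of_shaCorankZeroOddPrime hA hpar hX)

/-- **The rung leaf S1⁺ `GoldfeldAllTwistsX049` from the L-free leaf**, through the route's deciding
theorem `Theses.GoldfeldAllTwistsTwoConverse.closes`: inputs BCST Thm. A (`hA`), `p`-parity (`hpar`), the
leaf (`hX`), the formula twin `BSDTwoCMSplitRankOne` (item 19350, `hL`) and `PublishedFactsAllTwists` (item
19351, `hF`). Honest reading: Goldfeld `1/2, 1/2, 0` + rank BSD + `BSD(·,2)` over ALL twists of `X₀(49)`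
GRANTED the twin, the printed facts, and finiteness of `Ш[p^∞]` at one odd ordinary prime for every
corank-one additive twist. [cite: BurungaleCastellaSkinnerTian2022, Thm. A (p. 326)]
[cite: DokchitserDokchitserAnnals2010, Thm. 1.4] -/
theorem goldfeldAllTwistsX049_of_shaCorankZeroOddPrime
    (hA : thmA_analyticRank_eq_one_of_selmerCorank_eq_one)
    (hpar : ∀ (W : WeierstrassCurve ℚ) [W.IsElliptic] (p : ℕ) [Fact p.Prime], p_parity W p)
    (hX : ShaCorankZeroOddPrimeCMSevenAdditiveTwo)
    (hL : Summit.BirchSwinnertonDyer.BirchSwinnertonDyer.Theses.GoldfeldAllTwistsTwoConverse.BSDTwoCMSplitRankOne)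
    (hF : Summit.BirchSwinnertonDyer.BirchSwinnertonDyer.Theses.GoldfeldAllTwistsTwoConverse.PublishedFactsAllTwists) :
    GoldfeldAllTwistsX049 :=
  Summit.BirchSwinnertonDyer.BirchSwinnertonDyer.Theses.GoldfeldAllTwistsTwoConverse.closes
    (rankOneTwoConverseCMSevenAtAnyTwo_of_shaCorankZeroOddPrime hA hpar hX) hL hF

end Summit.BirchSwinnertonDyer.BirchSwinnertonDyer.Theorems.GoldfeldGoodTwists

end
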